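import Mathlib.FieldTheory.IsAlgClosed.AlgebraicClosure
import Literature.AlgebraicGeometry.HodgeTheory.AbsoluteHodgeClasses
import Literature.AlgebraicGeometry.HodgeTheory.GlobalInvariantCycles
import HarnessLib

/-!
# Absolute Hodge classes spread, over `ℚ̄`, to global flat sections (Voisin 2007, §3; Charles–Schnell, Thm. 11.3.17)

Topic `Literature/AlgebraicGeometry/HodgeTheory` (family `hodge`). Two NAMED FACTS (D-0014; the
absolute case and its weakly absolute strengthening, the latter implying the former), on the real carriers of `AbsoluteHodgeClasses.lean` (`IsAbsoluteHodgeClass`),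
`HodgeLocus.lean` (the espace étalé `FiberClass f k` of `Rᵏ f_* ℂ`, so that "a locally constant
global section `α̃ ∈ H⁰(T, R^{2k}π_*ℚ)` through `α`" is "a CONTINUOUS section
`τ : T(ℂ) → FiberClass f (2k)` of `FiberClass.pt` with `τ t = (t, α)`", exactly as in
`deligne_globalInvariantCycles`), `Motives/FamiliesVHS.lean` (`IsSmoothProjectiveFamily`, `fiberOver`)
and `Motives/BaseChange.lean` (`baseChangeHom σ` = `– ⊗_{ℚ̄,σ} ℂ`):

* `voisin2007_flatSpread_of_isAbsoluteHodgeClass` — the first sentence of Voisin's proof of her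
  Prop. 1.2 (*Hodge loci and absolute Hodge classes*, Compositio 143 (2007), §3; arXiv
  math/0605766 p. 6), for an absolute class `α` on a smooth projective complex `X`: *"there exist
  smooth irreducible quasi-projective varieties `𝒳, T` defined over `ℚ̄`, a projective morphism
  `π : 𝒳 → T`, and a locally constant global section `α̃ ∈ H⁰(T, R^{2k}π_*ℚ)`, such that `X` is one
  fiber of `π` and `α` is the restriction of `α̃` to this fiber."* Voisin obtains it from the
  algebraicity of the components of the locus of Hodge classes (her Thm. 2.3 = Cattani–Deligne–Kaplan)
  and Lemma 2.4 (the component through a (weakly) absolute class is defined over `ℚ̄`), base-changing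
  the family to (a smooth `ℚ̄`-model of) that component; Charles–Schnell prove the same content as
  Thm. 11.3.17 (arXiv:1101.3647 Thm. 47) via Thm. 11.3.15 (1) and Cor. 11.3.16 (Thm. 44 (1), 45): at a
  complex point of a `ℚ̄`-family an absolute class is an algebraic de Rham class defined over a
  finite extension of the function field, and its algebraic extension over the corresponding étale
  `ℚ̄`-neighbourhood is flat for the Gauss–Manin connection (a Baire-category argument) and a Hodge
  class at every point.
* `voisin2007_flatSpread_of_isWeaklyAbsoluteHodgeClass` — the SAME sentence for a weakly absolute
  class (Voisin, §3, first paragraph of the proof of Prop. 1.2: *"By the geometric interpretation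
  given above, and by Lemma 2.4 in the weakly absolute case, it follows that there exist …"*, the
  conclusion verbatim as above; Lemma 2.4: the component of the locus of Hodge classes through a
  weakly absolute class is defined over `ℚ̄`, by Thm. 2.3 and the countability of the Galois
  translates `λ_σ⁻¹ σ(S̃_α)`, `λ_σ² ∈ ℚ` by Rem. 2.2). Same Lean shape, `IsWeaklyAbsoluteHodgeClass`
  (Def. 2.1) in place of `IsAbsoluteHodgeClass`; it implies the absolute fact
  (`flatSpread_of_isAbsoluteHodgeClass_of_isWeaklyAbsolute`, proved: absolute ⟹ weakly absolute).
  Consumer: the strong-hypothesis bridge `QbarSummit ⟹ HodgeConjecture` (Voisin Prop. 1.2, weakly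
  absolute reading), `HodgeConjectureQbarVoisinOfFlatSpread.lean`.

Why named facts: both printed proofs need algebraic de Rham cohomology of smooth projective families
over non-closed fields with its Gauss–Manin connection and comparison with `Rᵏ f_* ℂ` (or the
Cattani–Deligne–Kaplan theorem), none of which is in the tree. Consumers: route
`HodgeConjecture/BoundaryReadout`, crux `AbsoluteReduction` (stmt-HodgeConjecture-15945), where with
Deligne's global invariant cycle theorem and the pull-back of algebraic classes it yields Voisin's
Prop. 1.2 (`Summit.….Theorems.absoluteReduction_of_absoluteSpreadSection`).

Not here: Voisin's Prop. 1.2 itself (`HodgeConjectureQbarVoisin.lean`; its `ℚ̄`-hypothesis form is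
derived from these facts in `HodgeConjectureQbarVoisinOfFlatSpread.lean`), Lemma 2.4 as a separate
statement (the locus of Hodge classes has no scheme structure in the tree), Hodge loci and their
fields of definition in general (`HodgeLocus.lean`, `HodgeGenericQbarDescent.lean`).

## References

* C. Voisin, *Hodge loci and absolute Hodge classes*, Compositio Math. 143 (2007) 945–958, §3, proof
  of Prop. 1.2, first paragraph; §2, Thm. 2.3 and Lemma 2.4 (arXiv math/0605766, pp. 4–6).
  [Voisin2007HodgeLoci]
* F. Charles, C. Schnell, *Notes on absolute Hodge classes*, in *Hodge Theory* (Math. Notes 49,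
  Princeton 2014), Thm. 11.3.15, Cor. 11.3.16, Thm. 11.3.17 (= arXiv:1101.3647, Thm. 44, 45, 47).
  [CharlesSchnell2014Notes]
-/

noncomputable section

open CategoryTheory AlgebraicGeometry

namespace Literature.AlgebraicGeometry.HodgeTheory

section HodgeTheory

/-- **Absolute Hodge classes spread, over `ℚ̄`, to global flat sections** (Voisin 2007, the first
sentence of the proof of Prop. 1.2, for an absolute class): *"there exist smooth irreducible
quasi-projective varieties `𝒳, T` defined over `ℚ̄`, a projective morphism `π : 𝒳 → T`, and a
locally constant global section `α̃ ∈ H⁰(T, R^{2k}π_*ℚ)`, such that `X` is one fiber of `π` and `α`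
is the restriction of `α̃` to this fiber"* (from Thm. 2.3 = Cattani–Deligne–Kaplan and Lemma 2.4
there; the same content is Charles–Schnell, Thm. 11.3.17 with Thm. 11.3.15 (1) and Cor. 11.3.16).
On the tree's carriers: for `X` smooth projective over `ℂ` of dimension `n` and
`c ∈ H²ᵖ(X(ℂ); ℂ)` absolute Hodge (`IsAbsoluteHodgeClass n X p c`), there are an embedding
`σ : ℚ̄ →+* ℂ`, quasi-projective `ℚ̄`-schemes `𝒳₀, T₀` with `T₀` smooth and `T₀ ⊗_σ ℂ` irreducible,
a `ℚ̄`-morphism `f₀ : 𝒳₀ ⟶ T₀` whose complexification `f₀ ⊗_σ ℂ` is a smooth projective family of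
relative dimension `n`, a complex point `t` of `T₀ ⊗_σ ℂ`, a `ℂ`-isomorphism `e : X ≅ 𝒳_t`, and a
continuous global section `τ` of `FiberClass.pt` on the espace étalé `FiberClass (f₀ ⊗ σ) (2p)` of
`R²ᵖ f_* ℂ` (a locally constant global section) with `τ t = (t, (e⁻¹)^* c)`.
[cite: Voisin2007HodgeLoci, §3, proof of Prop. 1.2, first paragraph (arXiv math/0605766 p. 6); §2, Thm. 2.3 and Lemma 2.4]
[cite: CharlesSchnell2014Notes, Thm. 11.3.17, with Thm. 11.3.15 (1) and Cor. 11.3.16 (arXiv:1101.3647 Thm. 47, 44, 45)] -/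
def voisin2007_flatSpread_of_isAbsoluteHodgeClass : Prop :=
  ∀ ⦃n : ℕ⦄ ⦃X : Motives.SchemeOver ℂ⦄, Motives.IsSmoothProjective n X →
    ∀ (p : ℕ) (c : complexBetti X (2 * p)), IsAbsoluteHodgeClass n X p c →
      ∃ (σ : AlgebraicClosure ℚ →+* ℂ) (𝒳₀ T₀ : Motives.SchemeOver (AlgebraicClosure ℚ))
        (f₀ : 𝒳₀ ⟶ T₀) (t : Motives.ComplexPoints ((Motives.baseChangeHom σ).obj T₀))
        (e : X ≅ Motives.fiberOver ((Motives.baseChangeHom σ).map f₀) t),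
        IsQuasiProjectiveOver 𝒳₀ ∧ IsQuasiProjectiveOver T₀ ∧
        IrreducibleSpace ((Motives.baseChangeHom σ).obj T₀).left ∧ AlgebraicGeometry.Smooth T₀.hom ∧
        Motives.IsSmoothProjectiveFamily ((Motives.baseChangeHom σ).map f₀) n ∧
        ∃ τ : Motives.ComplexPoints ((Motives.baseChangeHom σ).obj T₀) →
            FiberClass ((Motives.baseChangeHom σ).map f₀) (2 * p),
          Continuous τ ∧ (∀ u, (τ u).pt = u) ∧ τ t = ⟨t, complexBetti.map e.inv (2 * p) c⟩

/-- **Weakly absolute Hodge classes spread, over `ℚ̄`, to global flat sections** (Voisin 2007, the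
first sentence of the proof of Prop. 1.2, weakly absolute case): *"By the geometric interpretation
given above, and by Lemma 2.4 in the weakly absolute case, it follows that there exist smooth
irreducible quasi-projective varieties `𝒳, T` defined over `ℚ̄`, a projective morphism `π : 𝒳 → T`,
and a locally constant global section `α̃ ∈ H⁰(T, R^{2k}π_*ℚ)`, such that `X` is one fiber of `π`
and `α` is the restriction of `α̃` to this fiber"* — here for `α` WEAKLY absolute (Def. 2.1: every
conjugate `α_σ` is `λ_σ γ_σ` with `γ_σ` rational, `λ_σ ∈ ℚ̄`), which Voisin obtains from Thm. 2.3
(Cattani–Deligne–Kaplan: the connected component `S̃_α` of the locus of Hodge classes through `α`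
is algebraic) and Lemma 2.4 (*"Let `α` be a weakly absolute Hodge class. Then the connected
component `S̃_α` of the locus of Hodge classes passing through `α` is defined (schematically) over
`ℚ̄`, and so is the Hodge locus of `α`"*: `λ_σ⁻¹ σ(S̃_α) = S̃_{γ_σ}` and `λ_σ² ∈ ℚ` (Rem. 2.2) leave
only countably many Galois translates), base-changing the family to a smooth Zariski-open of
`S̃_{α,red}`, over which `α` extends to the tautological flat section. On the tree's carriers, in
the same shape as `voisin2007_flatSpread_of_isAbsoluteHodgeClass`: for `X` smooth projective over
`ℂ` of dimension `n` and `c ∈ H²ᵖ(X(ℂ); ℂ)` weakly absolute Hodge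
(`IsWeaklyAbsoluteHodgeClass n X p c`), there are an embedding `σ : ℚ̄ →+* ℂ`, quasi-projective
`ℚ̄`-schemes `𝒳₀, T₀` with `T₀` smooth and `T₀ ⊗_σ ℂ` irreducible, a `ℚ̄`-morphism `f₀ : 𝒳₀ ⟶ T₀`
whose complexification `f₀ ⊗_σ ℂ` is a smooth projective family of relative dimension `n`, a
complex point `t` of `T₀ ⊗_σ ℂ`, a `ℂ`-isomorphism `e : X ≅ 𝒳_t`, and a continuous global section
`τ` of `FiberClass.pt` on the espace étalé `FiberClass (f₀ ⊗ σ) (2p)` of `R²ᵖ f_* ℂ` with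
`τ t = (t, (e⁻¹)^* c)`.
[cite: Voisin2007HodgeLoci, §3, proof of Prop. 1.2, first paragraph (arXiv math/0605766 p. 6); §2, Def. 2.1, Thm. 2.3 and Lemma 2.4 (pp. 4–5)] -/
def voisin2007_flatSpread_of_isWeaklyAbsoluteHodgeClass : Prop :=
  ∀ ⦃n : ℕ⦄ ⦃X : Motives.SchemeOver ℂ⦄, Motives.IsSmoothProjective n X →
    ∀ (p : ℕ) (c : complexBetti X (2 * p)), IsWeaklyAbsoluteHodgeClass n X p c →
      ∃ (σ : AlgebraicClosure ℚ →+* ℂ) (𝒳₀ T₀ : Motives.SchemeOver (AlgebraicClosure ℚ))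
        (f₀ : 𝒳₀ ⟶ T₀) (t : Motives.ComplexPoints ((Motives.baseChangeHom σ).obj T₀))
        (e : X ≅ Motives.fiberOver ((Motives.baseChangeHom σ).map f₀) t),
        IsQuasiProjectiveOver 𝒳₀ ∧ IsQuasiProjectiveOver T₀ ∧
        IrreducibleSpace ((Motives.baseChangeHom σ).obj T₀).left ∧ AlgebraicGeometry.Smooth T₀.hom ∧
        Motives.IsSmoothProjectiveFamily ((Motives.baseChangeHom σ).map f₀) n ∧
        ∃ τ : Motives.ComplexPoints ((Motives.baseChangeHom σ).obj T₀) →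
            FiberClass ((Motives.baseChangeHom σ).map f₀) (2 * p),
          Continuous τ ∧ (∀ u, (τ u).pt = u) ∧ τ t = ⟨t, complexBetti.map e.inv (2 * p) c⟩

/-- The weakly absolute spread implies the absolute one: an absolute Hodge class is weakly absolute
(`λ_σ = 1`, `IsAbsoluteHodgeClass.isWeaklyAbsoluteHodgeClass`), so
`voisin2007_flatSpread_of_isWeaklyAbsoluteHodgeClass → voisin2007_flatSpread_of_isAbsoluteHodgeClass`
— discharging the former discharges both. [cite: Voisin2007HodgeLoci, Def. 2.1 and §3, proof of Prop. 1.2 (first paragraph)] -/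
theorem flatSpread_of_isAbsoluteHodgeClass_of_isWeaklyAbsolute
    (h : voisin2007_flatSpread_of_isWeaklyAbsoluteHodgeClass) :
    voisin2007_flatSpread_of_isAbsoluteHodgeClass :=
  fun _ _ hX p c hc ↦ h hX p c hc.isWeaklyAbsoluteHodgeClass

end HodgeTheory

end Literature.AlgebraicGeometry.HodgeTheory

end
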